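import Summits.HubbardSuperconductivity.HubbardSuperconductivity.Theses.WeakCouplingBCS
import Literature.MathematicalPhysics.QuantumLattice.FreeFermiGasNoDWaveOrder

/-!
# Disproof of `WcbcsBcsConstruction` — findings (standing adversary, cdisprove; cycle 2, v3)

Crux (route `WeakCouplingBCS`, item stmt-HubbardSuperconductivity-2010, rank 4 "the research
programme"):
`∃ δ ∈ (0,1/2) ∃ U₀ > 0 ∃ C > 0 ∀ U ∈ (0,U₀) ∃ μ, (GC tracial density of hubbardTorusWith 2 (L+1) 1 U μ → 1-δ)
 ∧ exp(-C/U²) ≤ dWaveOrderParameter U μ`, where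
`dWaveOrderParameter U μ = liminf_{h→0⁺} liminf_L Re ω₀[H(1,U) - μN - h(Δ_d+Δ_d†)](Δ_d)/L²` (DWaveSource.lean).

## Verdict (cycles 1–2)
NOT refuted; no cheap kill exists and none is expected. The statement is the Kohn–Luttinger `d_{x²-y²}`
BCS ground state at weak repulsion: believed TRUE by physicists — at `t' = 0`, to order `U²`, "there is a
`d_{x²-y²}` ground state for `1 > n > 0.6`, and a `d_{xy}` ground state for `n < 0.6`"
[RaghuKivelsonScalapino2010, arXiv:1002.0591 p. 7 (§III, Fig. 2)], confirmed beyond leading order ("the phase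
diagram in the limit of `U → 0` for all densities `n` has been obtained in second-order in `U` calculations of
Refs. [Hlubina, Raghu]"; `d_{x²-y²}` at higher fillings, the `d_{xy}/d_{x²-y²}` boundary near `n ≈ 0.6` being
the fragile region, where "the `U → 0` theory fails at `U ≈ 0.08` already") [DengKozikProkofevSvistunov2015,
arXiv:1408.2088 p. 2] — so the typed SHAPE `e^{-C/U²}` (effective `B₁g` attraction `λ ∝ U²`) is right for
`δ ∈ (0, ≈0.4)`, and OPEN as mathematics (no superconducting phase has been constructed for any 2D
short-range lattice fermion model; `Literature.Barriers.HubbardSuperconductivity.WeakCouplingCeiling`,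
`…PerturbativeInvisibilityOfPairing`). A substantive refutation would be a proof of ABSENCE of `d`-wave order
at arbitrarily weak coupling for every doping in `(0,1/2)` — harder than the crux and against all evidence.
What the adversary delivers instead is the statement's LOAD-BEARING structure as checked Lean, now LANDED in
Literature (any file may import it):

## Landed (Literature; all sorry-free, std axioms)
* `Literature/MathematicalPhysics/QuantumLattice/GroundStateSourceBounds.lean` (p68431): for Hermitian `K, O`,
  `(h'-h)·Re ω_{K-hO}(O) ≤ E₀(K-hO) - E₀(K-h'O)` (`sub_mul_re_groundStateFunctional_le`), monotonicity
  of `h ↦ Re ω_{K-hO}(O)` (`re_groundStateFunctional_source_mono`), `E₀(K-hO) ≤ E₀(K)` if `Re ω_K(O) = 0`,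
  invariance of `ω` under invertible commuting symmetries, `-‖Y‖ ≤ E₀(Y)`, `|Re ω_A(X)| ≤ ‖X‖`.
* `…/DWaveSourceProofs.lean` (p68579): `U(1)` ⇒ the source-FREE tracial one-point function of every bond pair /
  local pair / pair field vanishes (`groundStateFunctional_hubbardTorusWith_pairField`), so
  `dWaveSourceDensity L U μ 0 = 0`; `|dWaveSourceDensity| ≤ 4√2` (liminf's junk-free);
  `dWaveSourceDensity` is MONOTONE in `h`, `≥ 0` for `h ≥ 0` (**no sign kill**), the source lowers the energy,
  and the ENERGY SANDWICH `E(0)-E(h) ≤ 2hL²·density(h)`, `(h'-h)·2L²·density(h) ≤ E(h)-E(h')`.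
* `…/DWaveOrderParameterProofs.lean` (p68681): the outer `liminf_{h→0⁺}` is an infimum —
  `dWaveOrderParameter U μ ≤ liminf_L density(h)` for EVERY `h > 0` (`dWaveOrderParameter_le_liminf`, the
  adversary's lever: ONE source strength suffices to bound `m` from above) and its converse
  (`le_dWaveOrderParameter_of_forall`); `0 ≤ m ≤ 4√2` always; the ENERGY FORM of a floor `ε ≤ m`: it forces
  `ε ≤ liminf_L [E(h)-E(2h)]/(2hL²)` at every `h > 0` (`le_liminf_energyDrop_of_le_dWaveOrderParameter`) and
  follows from `ε ≤ liminf_L [E(0)-E(h)]/(2hL²)` for small `h` (`le_dWaveOrderParameter_of_le_liminf_energyGain`);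
  `dWaveOrderParameter_eq_zero_of_sublinear_gain` (an `o(h)·L²` energy response kills `m`); refuted
  strengthenings `not_exp_le_liminf_sourceFree` (source off before `L → ∞`) and
  `liminf_nhdsGE_liminf_dWaveSourceDensity_le_zero` (closed filter `𝓝[≥] 0` collapses `m ≤ 0`).

## This file (crux level; imports the Theses file, so it is evidence, not a Theorems file)
* §1 read-back of the crux in this vocabulary (`wcbcsBcsConstruction_iff`, `Iff.rfl`).
* §2 `WcbcsBcsConstruction → (energy-drop floor at every h > 0 at the crux's μ(U))` and
  `(density matching ∧ linear energy-gain floor) → WcbcsBcsConstruction`: the order clause is a statement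
  about sourced GC ground-state ENERGIES; a proof must produce a LINEAR-in-`h` energy response
  `E_L(U,μ,0) - E_L(U,μ,h) ≳ 2h·e^{-C/U²}·L²` uniformly in large `L` — symmetry breaking, not perturbation
  theory (the free gas responds with `C h² log(1/h) L²`; no quasi-free trial state responds linearly at
  `U > 0`, `Literature.Barriers.HubbardSuperconductivity.GeneralizedHartreeFockNoPairing`).
* §3 refuted strengthenings at crux level: S1 (`not_WcbcsBcsConstructionSourceFree`), S2
  (`not_exp_le_dWaveOrderParameterClosed`), S3 PROVED (cycle 2): the window
  closed at `U = 0` is FALSE unconditionally — `dWaveOrderParameter 0 μ = 0` for every `μ`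
  (`Literature/…/FreeFermiGasNoDWaveOrder.lean`, built on the cycle-2 landings `BdGPairBlock.lean` p83573,
  `TorusShellCountUniform.lean` p84488, `PairedProductStates.lean`): the free gas gains only `O(s^{5/4})L²`
  from the pair source, so the floor `e^{-C/U²}` must be created by the interaction
  (`not_wcbcsBcsConstruction_closedWindow`).
* §4 documented NON-theorems (load-bearing but not provable here): `∃ μ` cannot become `∀ μ` (vacuum for
  `μ < -4`, band insulator for `μ > 4 + U`: density 0 or 2); `δ` cannot be universal over `(0,1/2)` with one
  window (AF/nesting as `δ → 0` at fixed `U`; the `d_{x²-y²}/d_{xy}` boundary `n ≈ 0.6` is fragile, Deng et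
  al. p. 2, so NO density-matched `μ` need exist there); the floor cannot be polynomial or the window closed
  (`PerturbativeInvisibilityOfPairing`); `C` is tied to the `B₁g` Kohn–Luttinger eigenvalue (`C > 1/α`):
  if the order-`U²` `B₁g` coupling vanished on ALL of `(0,1/2)` the true scale would be `≤ e^{-C/U³}` and the
  crux would be FALSE as typed (route kill criteria (ii)/(iii)); the printed evidence says attractive for
  `0 < δ ≲ 0.4` (RKS2010 p. 7; Deng et al. 2015 p. 2; Hlubina 1999).
* NUMERICS (indicative, floating point, NOT certified; kit job j013197, `kl/kl_kernel.py`, evidence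
  `compute-j013197.json`): second-order Kohn–Luttinger kernel at `t' = 0` per `D₄` irrep (singlet
  `U²χ₀(k+k')` for `A/B`, triplet `-U²χ₀(k-k')` for `E`; Fermi-curve measure `ds/((2π)²|∇ε|)`, `N_θ = 128`,
  `χ₀` on a `384²` grid, `T = 0.02`). Most attractive eigenvalue `λ_Γ/U²` (positive = attractive):
  `δ = 0.02: B1g 0.0305 (A2g 0.0101, E 0.0060)`, `δ = 0.10: B1g 0.0105 (A2g 0.0032, E 0.0025)`,
  `δ = 0.20: B1g 0.0050 (E 0.0011)`, `δ = 0.30: B1g 0.0024 (E 0.0006)`, `δ = 0.40: B1g 0.0007 (B2g 0.0005,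
  E 0.0005)`, `δ = 0.45: E 0.0006 > B2g 0.0006 > B1g 0.0002`, `δ = 0.48: B2g 0.0006 ≈ E 0.0005 > B1g 0.0001`.
  So `B₁g` LEADS on `δ ∈ (0, ≈0.42)` and loses to `E`/`B₂g` (`d_{xy}`) beyond, exactly the printed picture
  (RKS2010 p. 7: `d_{x²-y²}` for `1 > n > 0.6`); kill criterion (iii) does NOT fire. For provers: a safe
  choice is `δ ∈ [0.05, 0.3]`; the implied constant is LARGE (`C ≳ 1/λ_{B1g} ≈ 95` at `δ = 0.1`, `≈ 33` at
  `δ = 0.02`), i.e. the asserted order `e^{-C/U²}` is astronomically small but positive — consistent with the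
  crux as typed (only `∃ C`). DOS check: `ρ(n=0.8) = 0.184` matches Deng et al. (`ρ ≲ 0.185` at `n ≲ 0.8`).
* Targets (lead's stuck stubs): none handed over (payload.stuck_stubs = []).
* LINE `lro-seed-kink-bridge` (lead skeleton rev L4, `Cruxes/WcbcsBcsConstruction/Lines/lro-seed-kink-bridge.lean`,
  audited 2026-08-16): see §4 below — 0 stub-false, 0 stub-misstated; the composition runs through ONE stub
  `stub_bcsSeedCore` which the skeleton itself proves EQUIVALENT to the crux (`WcbcsBcsConstruction_of`,
  `bcsSeedCore_of_bcsConstruction`), so the line is an honest dictionary and all open content is the crux.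
* CYCLE-2 LANDINGS (Literature): `BdGPairBlock.lean` (p83573), `TorusShellCountUniform.lean` (p84488),
  `PairedProductStates.lean` (p85123), `FreeFermiGasNoDWaveOrder.lean` (p90936: `dWaveOrderParameter 0 μ = 0`).
  SUBMITTED p91737 (dry-run ACCEPT): `Theorems/WcbcsBcsConstruction/Negative/UniformCeiling.lean` — `dWaveOrderParameter U μ ≤ 71·U^{1/4}`
  for EVERY `μ ∈ ℝ` and `U ≥ 0` (interaction comparison + the free anchor; complements the workers' window ceiling
  `stub_orderParameterCeiling`, `O(√U log(1/U))` on compact `[μ₁,μ₂] ⊂ (-4,0)`), whence the refuted strengthenings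
  "`U`-independent floor", "`U^{1/8}` floor" and "closed window `Set.Ico 0 U₀`" of the crux, none needing density
  matching: any admissible floor `f(U)` must satisfy `f(U) ≤ 71 U^{1/4}` eventually; `e^{-C/U²}` does.
-/

set_option linter.dupNamespace false

namespace Summit.HubbardSuperconductivity.HubbardSuperconductivity.Cruxes.WcbcsBcsConstruction.Disproof

open Matrix Finset Filter Literature.MathematicalPhysics.QuantumLattice
  Literature.Probability.LatticeModels
open scoped Matrix.Norms.L2Operator ComplexOrder Topology
open Summit.HubbardSuperconductivity.HubbardSuperconductivity.Theses.WeakCouplingBCS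

/-! ### §1 Read-back -/

/-- The GC density-matching clause of the crux, named (evidence-file vocabulary only). -/
def DensityMatched (U μ δ : ℝ) : Prop :=
  Filter.Tendsto (fun L : ℕ => ((hubbardTorusWith 2 (L + 1) 1 U μ).groundStateFunctional
    totalNumber).re / ((L + 1 : ℕ) : ℝ) ^ 2) Filter.atTop (nhds (1 - δ))

/-- The sourced GC ground-state energy `E_L(U, μ, h) = E₀(H(1,U) - μN - h(Δ_d + Δ_d†))`. -/
noncomputable def E (L : ℕ) [NeZero L] (U μ h : ℝ) : ℝ := (dWaveSourceTorus L U μ h).groundEnergy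

/-- Read-back: the crux, verbatim. -/
theorem wcbcsBcsConstruction_iff :
    WcbcsBcsConstruction ↔
      ∃ δ ∈ Set.Ioo (0:ℝ) (1 / 2), ∃ U₀ : ℝ, 0 < U₀ ∧ ∃ C : ℝ, 0 < C ∧ ∀ U ∈ Set.Ioo (0:ℝ) U₀,
        ∃ μ : ℝ, DensityMatched U μ δ ∧ Real.exp (-C / U ^ 2) ≤ dWaveOrderParameter U μ :=
  Iff.rfl

/-! ### §2 Energy form of the crux -/

/-- **Necessary condition the crux imposes.** If `WcbcsBcsConstruction` holds then at its `δ, U₀, C`,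
for every `U ∈ (0, U₀)` there is a density-matched `μ` at which, for EVERY source strength `h > 0`,
`e^{-C/U²} ≤ liminf_L [E_{L+1}(U,μ,h) - E_{L+1}(U,μ,2h)] / (2h(L+1)²)`: the sourced energy per site keeps
dropping at rate `≥ 2e^{-C/U²}` between `h` and `2h`, however small `h`. -/
theorem energyDrop_floor_of_wcbcsBcsConstruction (hyp : WcbcsBcsConstruction) :
    ∃ δ ∈ Set.Ioo (0:ℝ) (1 / 2), ∃ U₀ : ℝ, 0 < U₀ ∧ ∃ C : ℝ, 0 < C ∧ ∀ U ∈ Set.Ioo (0:ℝ) U₀,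
      ∃ μ : ℝ, DensityMatched U μ δ ∧ ∀ h : ℝ, 0 < h →
        Real.exp (-C / U ^ 2) ≤ liminf (fun L : ℕ =>
          (E (L + 1) U μ h - E (L + 1) U μ (2 * h)) / (2 * h * (((L + 1 : ℕ) : ℝ)) ^ 2)) atTop := by
  obtain ⟨δ, hδ, U₀, hU₀, C, hC, H⟩ := hyp
  refine ⟨δ, hδ, U₀, hU₀, C, hC, fun U hU => ?_⟩
  obtain ⟨μ, hdens, hm⟩ := H U hU
  exact ⟨μ, hdens, fun h hh => le_liminf_energyDrop_of_le_dWaveOrderParameter U μ hh hm⟩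

/-- **Sufficient condition.** A density-matched `μ(U)` with a LINEAR energy-gain floor
`e^{-C/U²} ≤ liminf_L [E_{L+1}(U,μ,0) - E_{L+1}(U,μ,h)] / (2h(L+1)²)` for `h ∈ (0, h₀(U))` proves the crux:
the tracial functional, ground-state degeneracies and the `h`-liminf are NOT obstacles; only sourced
ground-state energy asymptotics are needed. -/
theorem wcbcsBcsConstruction_of_energyGain_floor
    (hyp : ∃ δ ∈ Set.Ioo (0:ℝ) (1 / 2), ∃ U₀ : ℝ, 0 < U₀ ∧ ∃ C : ℝ, 0 < C ∧ ∀ U ∈ Set.Ioo (0:ℝ) U₀,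
      ∃ μ : ℝ, DensityMatched U μ δ ∧ ∃ h₀ : ℝ, 0 < h₀ ∧ ∀ h ∈ Set.Ioo 0 h₀,
        Real.exp (-C / U ^ 2) ≤ liminf (fun L : ℕ =>
          (E (L + 1) U μ 0 - E (L + 1) U μ h) / (2 * h * (((L + 1 : ℕ) : ℝ)) ^ 2)) atTop) :
    WcbcsBcsConstruction := by
  obtain ⟨δ, hδ, U₀, hU₀, C, hC, H⟩ := hyp
  refine ⟨δ, hδ, U₀, hU₀, C, hC, fun U hU => ?_⟩
  obtain ⟨μ, hdens, h₀, hh₀, Hgain⟩ := H U hU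
  exact ⟨μ, hdens, le_dWaveOrderParameter_of_le_liminf_energyGain U μ hh₀ Hgain⟩

/-! ### §3 Refuted strengthenings (crux level) and the `U = 0` near-miss -/

/-- STRENGTHENING S1: the crux with the source switched off before `L → ∞`. -/
def WcbcsBcsConstructionSourceFree : Prop :=
  ∃ δ ∈ Set.Ioo (0:ℝ) (1 / 2), ∃ U₀ : ℝ, 0 < U₀ ∧ ∃ C : ℝ, 0 < C ∧ ∀ U ∈ Set.Ioo (0:ℝ) U₀, ∃ μ : ℝ,
    DensityMatched U μ δ ∧
    Real.exp (-C / U ^ 2) ≤ liminf (fun L : ℕ => dWaveSourceDensity (L + 1) U μ 0) atTop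

/-- **S1 is false** (for a trivial reason: `U(1)` kills the source-free one-point function): the source
and the order of limits are load-bearing. -/
theorem not_WcbcsBcsConstructionSourceFree : ¬ WcbcsBcsConstructionSourceFree := by
  rintro ⟨δ, -, U₀, hU₀, C, -, H⟩
  obtain ⟨μ, -, hle⟩ := H (U₀ / 2) ⟨by linarith, by linarith⟩
  exact not_exp_le_liminf_sourceFree C (U₀ / 2) μ hle

/-- STRENGTHENING S2: the order parameter with the non-punctured filter `𝓝[≥] 0`. -/
noncomputable def dWaveOrderParameterClosed (U μ : ℝ) : ℝ :=
  liminf (fun h : ℝ => liminf (fun L : ℕ => dWaveSourceDensity (L + 1) U μ h) atTop) (𝓝[≥] 0)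

/-- **S2 collapses**: no positive floor survives the closed filter, for ANY `(C, U, μ)`. -/
theorem not_exp_le_dWaveOrderParameterClosed (C U μ : ℝ) :
    ¬ Real.exp (-C / U ^ 2) ≤ dWaveOrderParameterClosed U μ :=
  not_exp_le_liminf_nhdsGE C U μ

/-- **S3 PROVED (cycle 2): the `U = 0` anchor.** The free Fermi gas has NO `d`-wave order at any
chemical potential: `dWaveOrderParameter 0 μ = 0` (`Literature/…/FreeFermiGasNoDWaveOrder.lean`,
`dWaveOrderParameter_zero_coupling_eq_zero`: BdG pair-block lower bound, Fermi-sea trial state, uniform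
shell count ⇒ the sourced free gas gains only `O(s^{5/4})L²`, a sub-linear response). -/
theorem dWaveOrderParameter_zero_eq_zero (μ : ℝ) : dWaveOrderParameter 0 μ = 0 :=
  dWaveOrderParameter_zero_coupling_eq_zero μ

/-- STRENGTHENING S3 (the `U`-window closed at `U = 0`, where Lean reads `exp(-C/0²) = exp 0 = 1`) is
FALSE at EVERY `μ`, unconditionally: the floor `e^{-C/U²}` has to be created by the interaction. -/
theorem not_floor_at_zero_coupling (C μ : ℝ) :
    ¬ Real.exp (-C / (0 : ℝ) ^ 2) ≤ dWaveOrderParameter 0 μ := by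
  rw [dWaveOrderParameter_zero_eq_zero μ]
  exact (Real.exp_pos _).not_ge

/-- Hence the crux's window `Set.Ioo 0 U₀` cannot be replaced by `Set.Ico 0 U₀`: the closed-window
variant of `WcbcsBcsConstruction` is false (witness `U = 0`, any `δ, U₀, C`, every `μ`). -/
theorem not_wcbcsBcsConstruction_closedWindow :
    ¬ (∃ δ ∈ Set.Ioo (0:ℝ) (1 / 2), ∃ U₀ : ℝ, 0 < U₀ ∧ ∃ C : ℝ, 0 < C ∧ ∀ U ∈ Set.Ico (0:ℝ) U₀,
        ∃ μ : ℝ, DensityMatched U μ δ ∧ Real.exp (-C / U ^ 2) ≤ dWaveOrderParameter U μ) := by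
  rintro ⟨δ, -, U₀, hU₀, C, -, H⟩
  obtain ⟨μ, -, hle⟩ := H 0 ⟨le_rfl, hU₀⟩
  exact not_floor_at_zero_coupling C μ hle

/-- The a priori window every proof and every refutation lives in: `0 ≤ m(U,μ) ≤ 4√2` for ALL `U, μ`
(so the crux's floor needs `C/U² ≥ -log(4√2)`, vacuous for small `U`, and no sign/size argument refutes it). -/
theorem dWaveOrderParameter_mem_Icc (U μ : ℝ) :
    dWaveOrderParameter U μ ∈ Set.Icc 0 (2 * ∑ e ∈ insert (0 : Site 2) unitSteps, |dWaveFormFactor e / Real.sqrt 2|) :=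
  ⟨dWaveOrderParameter_nonneg U μ, dWaveOrderParameter_le_const U μ⟩

/-! ### §4 Line `lro-seed-kink-bridge` (rev L4) — stub audit (cdisprove doubles as drefute; D-0016)

Read: the skeleton (rev L4, gen-1 lead), `Lines/lro-seed-kink-bridge.md`, `PICKED.md`, the gen-0 drefute note
`Drefute-lro-seed-kink-bridge.md` (rev L1: 5/5 survived), and the landed Theorems files named below.

* JOINT SUFFICIENCY — honest. `WcbcsBcsConstruction_of` consumes only `stub_bcsSeedCore` (+ the in-skeleton theorem
  `orderFloor_of_seeds`, itself p73068∘p72109∘p72669 + kink algebra), and `bcsSeedCore_of_bcsConstruction` proves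
  crux ⇒ core (`C ↦ C+1`, `U₀ ↦ min U₀ 1`, via p76320). Nothing is smuggled; conversely nothing is gained: the core
  stub IS the crux (pointwise-in-`(U,μ)` seeds of strength `e^{-C/U²}` at a density-matched `μ`). No cheap attack on
  it exists beyond those on the crux recorded in §§2–3 and in `Negative/UniformCeiling.lean`.
* `stub_interactionComparison` — TRUE for every `L ≥ 1` (checked incl. `L = 1`: `Δ_d = 0` since `Σ_e d(e) = 0`, and
  `L = 2`: doubled bonds, argument unchanged): concavity of `h ↦ E₀(H_{U,h})` with supergradient `-2L²D_L`
  (`dWaveSourceDensity_mul_le_groundEnergy_drop`) and `0 ≤ E₀(H_{U',h}) - E₀(H_{U,h}) ≤ (U'-U)L²`; `0 ≤ U` NOT needed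
  (only `U ≤ U'`). LANDED by workers: `…Theorems/WeakCouplingBCSWcbcsBcsConstructionInteractionComparison.lean`.
  ADVERSARIAL USE: its upper half + the free anchor give the uniform ceiling `m(U,μ) ≤ 71 U^{1/4}` (Negative file).
* `stub_freeSourcedGroundEnergy` — TRUE (`L ≥ 3`): `H_{0,s} = Σ_k [ξ_k(n_{k↑}+n_{-k↓}) - a_k(b_k+b_k†)]`,
  `a_k = -2√2 s ĝ_k` (`dWaveSourceTorus_zero_eq_sum_pairBlock`, FreeFermiGasNoDWaveOrder), blocks on disjoint mode
  pairs `(k↑,-k↓)` commute and are even, block minimum `ξ - √(ξ²+a²) ≤ min(ξ, 0, 2ξ)`; the LOWER half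
  `Σ_k(ξ_k - √(ξ_k²+a_k²)) ≤ E₀` is my `sum_bdgLevel_le_groundEnergy_dWaveSourceTorus_zero` (p90936). LANDED in full by
  workers (`…FreeSourcedGroundEnergy.lean`, `β → ∞` in the BdG partition function).
* `stub_dWaveCooperSumLowerBound` — TRUE: for `μ` in a compact of `(-4,0)` the `ĝ_d²`-weighted Fermi-curve measure
  `N_d(μ) = ∮ ĝ² ds/|∇ε| > 0` (ĝ vanishes only on the diagonals), Riemann sums converge for fixed `h`, and
  `∫ ĝ²/√(ξ²+h²) = 2N_d log(1/h) + O(1)`; `c` may depend on `μ₁, μ₂` (it must: `N_d → 0` at the band bottom where the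
  Fermi circle shrinks and `ĝ ≲ (4+μ)/2`), which the quantifier order `∀ μ₁ μ₂ … ∃ c` allows. LANDED (`…DWaveCooperSumLowerBound.lean`).
* `stub_secantSlopes_of_concave_close` — TRUE (secant slopes of a concave `f` are monotone in the step; compare at
  `t = r`; `M < 0` or `η < 0` make the hypotheses unsatisfiable, harmless). LANDED (`…SecantSlopes.lean`).
* `stub_gcDensity_limitPoints_near_free` — TRUE (Griffiths: limit points of `n_L` lie in `[-D⁻e_U(μ), -D⁺e_U(μ)]`;
  `0 ≤ e_U - e_0 ≤ U` needs the hypothesis `0 ≤ U`, which is used; `limUnder` is not junk since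
  `torusEnergyDensityLimit` holds for all `U, μ`). LANDED (`…GcDensityLimitPointsNearFree.lean`).
* `stub_eosTransfer` — TRUE (MVT + equicontinuity: `h ↦ n h μ` is Cauchy as `h ↓ 0`, the limit is the two-sided
  derivative of `e₀` at interior `μ`, modulus inherited with `≤`). LANDED (`…EosTransfer.lean`).
* VERDICT for the lead: the line is saturated — every side stub is a theorem, the core is the crux. What the
  adversary can still say is quantitative and is in `Negative/UniformCeiling.lean`: the order the crux wants lives in
  `[e^{-C/U²}, 71 U^{1/4}]` for every `μ` (and below `C√U(1+log(1/U))` on doping windows, workers' ceiling); all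
  stairs `h ≫ U^{3/4}` are free-gas stairs, so seeds/kinks must be produced at `h ≲ U^{3/4}` — in fact at
  `h ≲ e^{-C/U²}`, the Kohn–Luttinger scale, where no expansion in the tree converges
  (`Literature.Barriers.HubbardSuperconductivity.WeakCouplingCeiling`, `PerturbativeInvisibilityOfPairing`).
-/

end Summit.HubbardSuperconductivity.HubbardSuperconductivity.Cruxes.WcbcsBcsConstruction.Disproof
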